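import Mathlib
import Summits.Ventures.PercRepro2.OneEdge
import Summits.Ventures.PercRepro2.KPrimeReduction
import Summits.Ventures.PercRepro2.KPrimeVYDict
import Summits.Ventures.PercRepro2.KPrimeLeakPendant
import Summits.Ventures.PercRepro2.KPrimeLeakLinear
import Summits.Ventures.PercRepro2.KPrimeLeakGlueO1
import Summits.Ventures.PercRepro2.SameClusterAvoid

/-!
# The unfrozen glue: `(GLUE ≥ 0)` is implied by the monotonicity of a clean potential
(blind cell PercRepro2, mine-c g37; `conjectures/MINE-C.md` §46.10)

With `Num(q) := P_q(Y∩S)·P_q(U∩Ω) + P_q(S)·(P_q((0,1)) − P_q(U∩Y∩Ω))` (the numerator of the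
E-slope, `slopeNum`) the frozen glue of `KPrimeLeakLinear.lean` satisfies the EXACT identity

  `leakGlue · P¹¹(S) = uGlue + P¹¹(U∩Ω) · P⁰(N) · bridgePA`,

where `uGlue := Num(p¹¹)·P⁰(S)·P⁰(N) − Num(p⁰)·P¹¹(S)·P¹¹(N)` (the unfrozen glue: the potential
`F(q) = Num(q)/(P_q(S)·P_q(N))` compared between the leak-closed world `p⁰ = p[e₂ ↦ 0]` and the
glued world `p¹¹ = p[e₂ ↦ 1][e₁ ↦ 1]`, in which `a₁` and `z` are identified) and
`bridgePA := P⁰(Y∩S)·P¹¹(S) − P⁰(S)·P¹¹(Y∩S)` is the PA term at the bridge — a THEOREM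
(`bridgePA_nonneg`): in the glued world `S` and `Y ∩ S` are the leak-closed events cut to
`{a₂ ↮ z}` (`prob_glued_S_eq`, `prob_glued_YS_eq`), and the cluster of `a₂` conditioned to avoid
`{a₁, v}` is positively associated (`nuPrime_pa`, BHK06 Thm 1.3), so adding the avoidance of `z`
lowers the conditional probability of `a₂ ↔ y`.  Hence `0 ≤ uGlue → 0 ≤ leakGlue · P¹¹(S)`
(`leakGlue_mul_nonneg_of_uGlue_nonneg`), i.e. the candidate (UGLUE ≥ 0) — «the potential `F` does
not fall when `a₁`'s root grows by `z`» — implies the candidate (GLUE ≥ 0) of §46.3.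
-/

namespace Summit.Ventures.PercRepro2

namespace KPrime

variable {V : Type*} {E : Type*} [Fintype E] [DecidableEq E] [Fintype V] [DecidableEq V]
  {R : Type*} [Field R] [LinearOrder R] [IsStrictOrderedRing R]

section Defs

variable (ends : E → Sym2 V) (a₁ a₂ v y : V)

/-- The E-slope numerator `Num(q) = P_q(Y∩S)·P_q(U∩Ω) + P_q(S)·(P_q((0,1)) − P_q(U∩Y∩Ω))`
(`= P_q(S)²·s`, the slope of `KPrimeCovSplit`). -/
noncomputable def slopeNum (q : E → R) : R :=
  prob q (connEvent ends a₂ y ∩ S ends a₁ a₂ v) * prob q (connEvent ends a₁ v ∩ Ω ends a₁ a₂) +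
    prob q (S ends a₁ a₂ v) *
      (prob q (cls01 ends a₁ a₂ v y) -
        prob q (connEvent ends a₁ v ∩ connEvent ends a₂ y ∩ Ω ends a₁ a₂))

/-- The unfrozen glue `Num(p¹¹)·P⁰(S)·P⁰(N) − Num(p⁰)·P¹¹(S)·P¹¹(N)`: nonnegative iff the
potential `F(q) = Num(q)/(P_q(S)·P_q(N))` does not fall from the leak-closed world
`p⁰ = p[e₂ ↦ 0]` to the glued world `p¹¹ = p[e₂ ↦ 1][e₁ ↦ 1]`. -/
noncomputable def uGlue (p : E → R) (e₁ e₂ : E) : R :=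
  slopeNum ends a₁ a₂ v y (Function.update (Function.update p e₂ 1) e₁ 1) *
      (prob (Function.update p e₂ 0) (S ends a₁ a₂ v) *
        prob (Function.update p e₂ 0) (N ends a₁ a₂ v)) -
    slopeNum ends a₁ a₂ v y (Function.update p e₂ 0) *
      (prob (Function.update (Function.update p e₂ 1) e₁ 1) (S ends a₁ a₂ v) *
        prob (Function.update (Function.update p e₂ 1) e₁ 1) (N ends a₁ a₂ v))

/-- The PA term at the bridge: `P⁰(Y∩S)·P¹¹(S) − P⁰(S)·P¹¹(Y∩S)`. -/
noncomputable def bridgePA (p : E → R) (e₁ e₂ : E) : R :=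
  prob (Function.update p e₂ 0) (connEvent ends a₂ y ∩ S ends a₁ a₂ v) *
      prob (Function.update (Function.update p e₂ 1) e₁ 1) (S ends a₁ a₂ v) -
    prob (Function.update p e₂ 0) (S ends a₁ a₂ v) *
      prob (Function.update (Function.update p e₂ 1) e₁ 1) (connEvent ends a₂ y ∩ S ends a₁ a₂ v)

omit [Fintype V] [LinearOrder R] [IsStrictOrderedRing R] in
/-- **The exact identity** `leakGlue · P¹¹(S) = uGlue + P¹¹(U∩Ω) · P⁰(N) · bridgePA`. -/
theorem leakGlue_mul_eq (p : E → R) (e₁ e₂ : E) :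
    leakGlue ends a₁ a₂ v y p e₁ e₂ *
        prob (Function.update (Function.update p e₂ 1) e₁ 1) (S ends a₁ a₂ v) =
      uGlue ends a₁ a₂ v y p e₁ e₂ +
        prob (Function.update (Function.update p e₂ 1) e₁ 1) (connEvent ends a₁ v ∩ Ω ends a₁ a₂) *
          prob (Function.update p e₂ 0) (N ends a₁ a₂ v) * bridgePA ends a₁ a₂ v y p e₁ e₂ := by
  unfold leakGlue uGlue slopeNum bridgePA
  ring

end Defs

section Bridge

variable {ends : E → Sym2 V} {a₁ a₂ b v y z : V} {e₁ e₂ : E} {p : E → R}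

omit [Fintype E] [Fintype V] [DecidableEq V] [Field R] [LinearOrder R]
  [IsStrictOrderedRing R] in
/-- With the bridge `e₁ = {b, a₁}` opened on top of `ω'` (`b` a leaf at `z` by the open `e₂`),
`s ↔ x` for `s, x ≠ b` is `s ↔ x`, or `s ↔ a₁ ∧ z ↔ x`, or `s ↔ z ∧ a₁ ↔ x` in `ω'`. -/
lemma conn_update_true_iff_bridge (hb : ∀ f, b ∈ ends f → f = e₁ ∨ f = e₂)
    (h₁ : ends e₁ = s(b, a₁)) (h₂ : ends e₂ = s(b, z)) (hne : e₁ ≠ e₂) {ω' : Config E}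
    (hf : ω' e₁ = false) (hg : ω' e₂ = true) {s x : V} (hs : s ≠ b) (hx : x ≠ b) :
    Conn ends (Function.update ω' e₁ true) s x ↔
      Conn ends ω' s x ∨ (Conn ends ω' s z ∧ Conn ends ω' a₁ x) ∨
        (Conn ends ω' s a₁ ∧ Conn ends ω' z x) := by
  have hb' : ∀ f, b ∈ ends f → f = e₂ ∨ f = e₁ := fun f h => (hb f h).symm
  have hbz : ∀ {t : V}, t ≠ b → (Conn ends ω' t b ↔ Conn ends ω' t z) := fun ht =>
    conn_b_iff_conn_x₁ (f := e₂) (g := e₁) (x₁ := z) hb' h₂ hne.symm hf hg ht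
  have hsb : Conn ends ω' s b ↔ Conn ends ω' s z := hbz hs
  have hbx : Conn ends ω' b x ↔ Conn ends ω' z x := by
    constructor
    · intro h; exact conn_symm ((hbz hx).1 (conn_symm h))
    · intro h; exact conn_symm ((hbz hx).2 (conn_symm h))
  rw [OneEdge.conn_update_true_iff h₁, hsb, hbx]

omit [Fintype V] [IsStrictOrderedRing R] in
/-- **The leak dictionary for `S`**: `P¹¹(S) = P¹⁰(S ∩ {a₂ ↮ z})`. -/
lemma prob_glued_S_eq (hb : ∀ f, b ∈ ends f → f = e₁ ∨ f = e₂) (h₁ : ends e₁ = s(b, a₁))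
    (h₂ : ends e₂ = s(b, z)) (hne : e₁ ≠ e₂) (hba₁ : b ≠ a₁) (hba₂ : b ≠ a₂) (hbv : b ≠ v) :
    prob (Function.update (Function.update p e₂ 1) e₁ 1) (S ends a₁ a₂ v) =
      prob (Function.update (Function.update p e₂ 1) e₁ 0)
        (S ends a₁ a₂ v ∩ avoidAll ends a₂ {z}) := by
  have he : Function.update (Function.update p e₂ 1) e₁ 0 e₁ ≠ 1 := by simp
  have h11 : Function.update (Function.update p e₂ 1) e₁ 1 =
      Function.update (Function.update (Function.update p e₂ 1) e₁ 0) e₁ 1 := by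
    rw [Function.update_idem]
  have h10 : Function.update (Function.update p e₂ 1) e₁ 0 =
      Function.update (Function.update (Function.update p e₂ 1) e₁ 0) e₁ 0 := by
    rw [Function.update_idem]
  rw [h11]
  conv_rhs => rw [h10]
  apply prob_update_one_eq_update_zero_of_iff he
  intro ω hω
  have hω₂ : ω e₂ = true := open_e₂_of_sure hne hω
  set ω' := Function.update ω e₁ false with hω'
  have hf : ω' e₁ = false := by simp [hω']
  have hg : ω' e₂ = true := by simp [hω', Function.update_of_ne hne.symm, hω₂]
  have hup : Function.update ω e₁ true = Function.update ω' e₁ true := by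
    simp [hω', Function.update_idem]
  rw [hup]
  have hrefl : Conn ends ω' a₁ a₁ := conn_refl ends ω' a₁
  simp only [S, avoidAll, Set.mem_inter_iff, Set.mem_setOf_eq, Finset.mem_insert,
    Finset.mem_singleton, forall_eq_or_imp, forall_eq]
  rw [conn_update_true_iff_bridge hb h₁ h₂ hne hf hg (Ne.symm hba₂) (Ne.symm hba₁),
    conn_update_true_iff_bridge hb h₁ h₂ hne hf hg (Ne.symm hba₂) (Ne.symm hbv)]
  tauto

omit [Fintype V] [IsStrictOrderedRing R] in
/-- **The leak dictionary for `Y ∩ S`**: `P¹¹(Y ∩ S) = P¹⁰(Y ∩ S ∩ {a₂ ↮ z})`. -/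
lemma prob_glued_YS_eq (hb : ∀ f, b ∈ ends f → f = e₁ ∨ f = e₂) (h₁ : ends e₁ = s(b, a₁))
    (h₂ : ends e₂ = s(b, z)) (hne : e₁ ≠ e₂) (hba₁ : b ≠ a₁) (hba₂ : b ≠ a₂) (hbv : b ≠ v)
    (hby : b ≠ y) :
    prob (Function.update (Function.update p e₂ 1) e₁ 1)
        (connEvent ends a₂ y ∩ S ends a₁ a₂ v) =
      prob (Function.update (Function.update p e₂ 1) e₁ 0)
        (connEvent ends a₂ y ∩ S ends a₁ a₂ v ∩ avoidAll ends a₂ {z}) := by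
  have he : Function.update (Function.update p e₂ 1) e₁ 0 e₁ ≠ 1 := by simp
  have h11 : Function.update (Function.update p e₂ 1) e₁ 1 =
      Function.update (Function.update (Function.update p e₂ 1) e₁ 0) e₁ 1 := by
    rw [Function.update_idem]
  have h10 : Function.update (Function.update p e₂ 1) e₁ 0 =
      Function.update (Function.update (Function.update p e₂ 1) e₁ 0) e₁ 0 := by
    rw [Function.update_idem]
  rw [h11]
  conv_rhs => rw [h10]
  apply prob_update_one_eq_update_zero_of_iff he
  intro ω hω
  have hω₂ : ω e₂ = true := open_e₂_of_sure hne hω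
  set ω' := Function.update ω e₁ false with hω'
  have hf : ω' e₁ = false := by simp [hω']
  have hg : ω' e₂ = true := by simp [hω', Function.update_of_ne hne.symm, hω₂]
  have hup : Function.update ω e₁ true = Function.update ω' e₁ true := by
    simp [hω', Function.update_idem]
  rw [hup]
  have hrefl : Conn ends ω' a₁ a₁ := conn_refl ends ω' a₁
  simp only [S, avoidAll, Set.mem_inter_iff, Set.mem_setOf_eq, Finset.mem_insert,
    Finset.mem_singleton, forall_eq_or_imp, forall_eq, mem_connEvent]
  rw [conn_update_true_iff_bridge hb h₁ h₂ hne hf hg (Ne.symm hba₂) (Ne.symm hby),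
    conn_update_true_iff_bridge hb h₁ h₂ hne hf hg (Ne.symm hba₂) (Ne.symm hba₁),
    conn_update_true_iff_bridge hb h₁ h₂ hne hf hg (Ne.symm hba₂) (Ne.symm hbv)]
  tauto

/-- **The PA term at the bridge is nonnegative**: `P⁰(S)·P¹¹(Y∩S) ≤ P⁰(Y∩S)·P¹¹(S)` — adding
the avoidance of `z` to the avoidance of `{a₁, v}` does not raise the conditional probability of
`a₂ ↔ y` (the cluster of `a₂` given `a₂ ↮ {a₁, v}` is positively associated, `nuPrime_pa`). -/
theorem bridgePA_nonneg (hp : IsProbVec p) (hb : ∀ f, b ∈ ends f → f = e₁ ∨ f = e₂)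
    (h₁ : ends e₁ = s(b, a₁)) (h₂ : ends e₂ = s(b, z)) (hne : e₁ ≠ e₂)
    (hba₁ : b ≠ a₁) (hba₂ : b ≠ a₂) (hbv : b ≠ v) (hby : b ≠ y) :
    0 ≤ bridgePA ends a₁ a₂ v y p e₁ e₂ := by
  have hb' : ∀ f, b ∈ ends f → f = e₂ ∨ f = e₁ := fun f h => (hb f h).symm
  have hp'' : IsProbVec (Function.update (Function.update p e₂ 1) e₁ 0) :=
    (hp.update e₂ zero_le_one le_rfl).update e₁ le_rfl zero_le_one
  have hSX : ∀ x ∈ ({a₁, v} : Finset V), x ≠ b := fun x hx => by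
    simp only [Finset.mem_insert, Finset.mem_singleton] at hx
    rcases hx with rfl | rfl
    · exact Ne.symm hba₁
    · exact Ne.symm hbv
  have hS₁ : PendInv e₁ e₂ (S ends a₁ a₂ v) := pendInv_avoidAll hb h₁ hne (Ne.symm hba₂) hSX
  have hS₂ : PendInv e₂ e₁ (S ends a₁ a₂ v) := pendInv_avoidAll hb' h₂ hne.symm (Ne.symm hba₂) hSX
  have hYS₁ : PendInv e₁ e₂ (connEvent ends a₂ y ∩ S ends a₁ a₂ v) :=
    (pendInv_connEvent hb h₁ hne (Ne.symm hba₂) (Ne.symm hby)).inter hS₁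
  have hYS₂ : PendInv e₂ e₁ (connEvent ends a₂ y ∩ S ends a₁ a₂ v) :=
    (pendInv_connEvent hb' h₂ hne.symm (Ne.symm hba₂) (Ne.symm hby)).inter hS₂
  unfold bridgePA
  rw [← prob_pendantZ_eq_leakClosed hne hS₁ hS₂, ← prob_pendantZ_eq_leakClosed hne hYS₁ hYS₂,
    prob_glued_S_eq hb h₁ h₂ hne hba₁ hba₂ hbv, prob_glued_YS_eq hb h₁ h₂ hne hba₁ hba₂ hbv hby]
  set q := Function.update (Function.update p e₂ 1) e₁ 0 with hq
  -- the complements: `{a₂ ↮ z}ᶜ = {a₂ ↔ z}`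
  have hcompl : (avoidAll ends a₂ {z})ᶜ = connEvent ends a₂ z := by
    ext ω
    simp [avoidAll, connEvent]
  have eS := prob_inter_add_prob_inter_compl q (S ends a₁ a₂ v) (avoidAll ends a₂ {z})
  have eYS := prob_inter_add_prob_inter_compl q (connEvent ends a₂ y ∩ S ends a₁ a₂ v)
    (avoidAll ends a₂ {z})
  rw [hcompl] at eS eYS
  -- PA of the avoided cluster of `a₂`
  have key := nuPrime_pa q hp'' ends z a₁ a₂ v y
  have e1 : connEvent ends a₂ y ∩ avoidAll ends a₂ {a₁, v} = connEvent ends a₂ y ∩ S ends a₁ a₂ v :=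
    rfl
  have e2 : connEvent ends a₂ z ∩ avoidAll ends a₂ {a₁, v} = S ends a₁ a₂ v ∩ connEvent ends a₂ z := by
    ext ω; simp only [S, Set.mem_inter_iff]; tauto
  have e3 : connEvent ends a₂ y ∩ connEvent ends a₂ z ∩ avoidAll ends a₂ {a₁, v} =
      connEvent ends a₂ y ∩ S ends a₁ a₂ v ∩ connEvent ends a₂ z := by
    ext ω; simp only [S, Set.mem_inter_iff]; tauto
  have e4 : avoidAll ends a₂ {a₁, v} = S ends a₁ a₂ v := rfl
  rw [e1, e2, e3, e4] at key
  have hZ1 : prob q (S ends a₁ a₂ v ∩ avoidAll ends a₂ {z}) =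
      prob q (S ends a₁ a₂ v) - prob q (S ends a₁ a₂ v ∩ connEvent ends a₂ z) := by linarith
  have hZ2 : prob q (connEvent ends a₂ y ∩ S ends a₁ a₂ v ∩ avoidAll ends a₂ {z}) =
      prob q (connEvent ends a₂ y ∩ S ends a₁ a₂ v) -
        prob q (connEvent ends a₂ y ∩ S ends a₁ a₂ v ∩ connEvent ends a₂ z) := by linarith
  rw [hZ1, hZ2]
  nlinarith [key]

end Bridge

section Conclusion

variable {ends : E → Sym2 V} {a₁ a₂ b v y z : V} {e₁ e₂ : E} {p : E → R}

/-- **(UGLUE ≥ 0) ⟹ (GLUE ≥ 0)**: if the potential does not fall, the frozen glue times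
`P¹¹(S)` is nonnegative. -/
theorem leakGlue_mul_nonneg_of_uGlue_nonneg (hp : IsProbVec p)
    (hb : ∀ f, b ∈ ends f → f = e₁ ∨ f = e₂) (h₁ : ends e₁ = s(b, a₁)) (h₂ : ends e₂ = s(b, z))
    (hne : e₁ ≠ e₂) (hba₁ : b ≠ a₁) (hba₂ : b ≠ a₂) (hbv : b ≠ v) (hby : b ≠ y)
    (hU : 0 ≤ uGlue ends a₁ a₂ v y p e₁ e₂) :
    0 ≤ leakGlue ends a₁ a₂ v y p e₁ e₂ *
      prob (Function.update (Function.update p e₂ 1) e₁ 1) (S ends a₁ a₂ v) := by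
  have hp' : IsProbVec (Function.update (Function.update p e₂ 1) e₁ 1) :=
    (hp.update e₂ zero_le_one le_rfl).update e₁ zero_le_one le_rfl
  have hp0 : IsProbVec (Function.update p e₂ 0) := hp.update e₂ le_rfl zero_le_one
  rw [leakGlue_mul_eq]
  have hPA := bridgePA_nonneg hp hb h₁ h₂ hne hba₁ hba₂ hbv hby
  have h1 := prob_nonneg hp' (connEvent ends a₁ v ∩ Ω ends a₁ a₂)
  have h2 := prob_nonneg hp0 (N ends a₁ a₂ v)
  positivity

/-- **(UGLUE ≥ 0) ⟹ (GLUE ≥ 0)** when `P¹¹(S) > 0`. -/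
theorem leakGlue_nonneg_of_uGlue_nonneg (hp : IsProbVec p)
    (hb : ∀ f, b ∈ ends f → f = e₁ ∨ f = e₂) (h₁ : ends e₁ = s(b, a₁)) (h₂ : ends e₂ = s(b, z))
    (hne : e₁ ≠ e₂) (hba₁ : b ≠ a₁) (hba₂ : b ≠ a₂) (hbv : b ≠ v) (hby : b ≠ y)
    (hS : 0 < prob (Function.update (Function.update p e₂ 1) e₁ 1) (S ends a₁ a₂ v))
    (hU : 0 ≤ uGlue ends a₁ a₂ v y p e₁ e₂) :
    0 ≤ leakGlue ends a₁ a₂ v y p e₁ e₂ :=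
  nonneg_of_mul_nonneg_left
    (leakGlue_mul_nonneg_of_uGlue_nonneg hp hb h₁ h₂ hne hba₁ hba₂ hbv hby hU) hS

end Conclusion

end KPrime

end Summit.Ventures.PercRepro2
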